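import Summits.CriticalPhenomena.CardyFormulaZ2.Theses.CardyBoundaryCoulombGas
import Summits.CriticalPhenomena.CardyFormulaZ2.Theorems.CardyBoundaryCoulombGasRectilinearCardyRowDefs
import Summits.CriticalPhenomena.CardyFormulaZ2.Theorems.CardyBoundaryCoulombGasRectilinearCardyStubFiniteCorners
import Summits.CriticalPhenomena.CardyFormulaZ2.Theorems.CardyBoundaryCoulombGasRectilinearCardyStubBoundaryArmTightness
import Summits.CriticalPhenomena.CardyFormulaZ2.Theorems.CardyBoundaryCoulombGasRectilinearCardyUniformFlatRadius
import Summits.CriticalPhenomena.CardyFormulaZ2.Theorems.CardyBoundaryCoulombGasRectilinearCardyLocalToGlobal2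
import Summits.CriticalPhenomena.CardyFormulaZ2.Theorems.CardyBoundaryCoulombGasRectilinearCardyStubBoundaryCorrespondence
import Summits.CriticalPhenomena.CardyFormulaZ2.Theorems.CardyBoundaryCoulombGasRectilinearCardyStubContinuumTail
import Summits.CriticalPhenomena.CardyFormulaZ2.Theorems.CardyBoundaryCoulombGasRectilinearCardyStubSchwarzExtension
import Summits.CriticalPhenomena.CardyFormulaZ2.Theorems.CardyBoundaryCoulombGasRectilinearCardyStubFlatMarksReduction
import Summits.CriticalPhenomena.CardyFormulaZ2.Theorems.CardyBoundaryCoulombGasRectilinearCardyStubKernelPointAsymptotics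
import Summits.CriticalPhenomena.CardyFormulaZ2.Theorems.CardyBoundaryCoulombGasRectilinearCardyStubKernelWindowLaw
import Literature.Probability.RandomPlanarGeometry.ConformalRectangleProofs

/-!
# The crux `RectilinearCardy` is EQUIVALENT to the cube-root law — Part 1: tools
# (line `excursion-kernel-covariance`, crux stmt-CriticalPhenomena-5660, route `CardyBoundaryCoulombGas`)

Continuation lead `prover-line-stmt-CriticalPhenomena-5660-c1-0`, 2026-08-16 (cycle c1-1). After wave 1
of the reshaped skeleton `Cruxes/RectilinearCardy/Lines/excursion_kernel_covariance.lean` every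
registered stub except the lever is a tree theorem (`stub_flatMarksReduction` p119964,
`stub_boundaryCorrespondence` p118200, `stub_continuumTail` p118558, `stub_schwarzExtension` p119444,
`stub_kernelPointAsymptotics` p121243, `stub_kernelWindowLaw` p123083, plus the first lead's
`stub_boundaryArmTightness` p95609 and `stub_finiteCorners` p85706). Part 1 (this file) collects the
tools; Part 2 (`…IffCubeRootLaw.lean`) records the two consequences, both UNCONDITIONAL theorems of the tree:

* `rectilinearCardy_of_cubeRootLaw` — SUFFICIENCY (the skeleton with the lever as an explicit
  hypothesis): the cube-root law `CubeRootLaw` (the macroscopic, flat-marked, closure-discretised,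
  raw-mass double-ratio law: on pairs of fixed flat windows the increments of the percolation tail
  function `Q_δ = tailCrossingProb` are proportional to the increments of the cube-root kernel mass
  `rowMass`, with one constant, eventually up to relative error `ε`) implies Cardy's formula for bond
  percolation on `ℤ²` in every rectilinear conformal rectangle;
* `cubeRootLaw_of_rectilinearCardy` — NECESSITY: conversely the crux implies the cube-root law
  (apply the crux to the sub-rectangles `(Ω; a, b, ∂Ω(p), d)`, `p` in a flat window, whose crossing
  probability IS `Q_δ(p)`, and compare with the landed kernel window law);
* `rectilinearCardy_iff_cubeRootLaw` — hence the lever `stub_cubeRootLaw` is EXACTLY crux-sized: it is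
  a reformulation of Cardy's formula on rectilinear polygons as a local boundary density law read against
  the lattice polygon's own excursion kernels (the `(1,1,1;3)` member of the route's boundary Coulomb gas),
  the form in which the route's engine `BoundaryDefectGaussianR` (stmt-14132) is meant to deliver it —
  so the open support item `DensityIntegration` (stmt-14890, `BoundaryDefectGaussianR → RectilinearCardy`)
  is now reduced to `BoundaryDefectGaussianR → CubeRootLaw`.

The statement `CubeRootLaw` is written INLINE (it is the registered signature of `stub_cubeRootLaw`,
over the landed vocabulary `tailCrossingProb`, `rowMass`, `AdmissibleRange`, `FlatNear`, `IsRectilinear`).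
-/

noncomputable section

open Set Filter Topology MeasureTheory
open Literature.Probability.RandomPlanarGeometry
open Literature.Probability.Percolation (bondDomainCrossingProb discreteCrossingProb half)
open Summit.CriticalPhenomena.CardyFormulaZ2.Theorems.RectilinearCardy.Negative (IsRectilinear)
open Summit.CriticalPhenomena.CardyFormulaZ2.Theses.CardyBoundaryCoulombGas (RectilinearCardy)
open UpperHalfPlane (upperHalfPlaneSet)

namespace Summit.CriticalPhenomena.CardyFormulaZ2.Cruxes.RectilinearCardy.ExcursionKernelCovariance

/-! ### Elementary real inequalities -/

/-- Elementary transfer of a double-ratio law along a relative approximation: if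
`|a u' - a' u| ≤ ε (a u' + a' u)` and `u, u'` are `ε`-relatively close to `A, A' ≥ 0`, then
`|a A' - a' A| ≤ 3ε (a A' + a' A)` (for `0 ≤ ε ≤ 1`, `a, a' ≥ 0`). [folklore] -/
theorem doubleRatio_transfer {a a' u u' A A' ε : ℝ} (ha : 0 ≤ a) (ha' : 0 ≤ a') (hA : 0 ≤ A)
    (hA' : 0 ≤ A') (hε : 0 ≤ ε) (hε1 : ε ≤ 1)
    (hlaw : |a * u' - a' * u| ≤ ε * (a * u' + a' * u)) (hu : |u - A| ≤ ε * A)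
    (hu' : |u' - A'| ≤ ε * A') :
    |a * A' - a' * A| ≤ 3 * ε * (a * A' + a' * A) := by
  have hsplit : a * A' - a' * A = (a * u' - a' * u) + a * (A' - u') + a' * (u - A) := by ring
  have h1 : |a * (A' - u')| = a * |u' - A'| := by rw [abs_mul, abs_of_nonneg ha, abs_sub_comm]
  have h2 : |a' * (u - A)| = a' * |u - A| := by rw [abs_mul, abs_of_nonneg ha']
  have hU : u ≤ (1 + ε) * A := by have := (abs_le.1 hu).2; linarith
  have hU' : u' ≤ (1 + ε) * A' := by have := (abs_le.1 hu').2; linarith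
  calc |a * A' - a' * A|
      = |(a * u' - a' * u) + a * (A' - u') + a' * (u - A)| := by rw [hsplit]
    _ ≤ |a * u' - a' * u| + |a * (A' - u')| + |a' * (u - A)| := abs_add_three _ _ _
    _ ≤ ε * (a * u' + a' * u) + a * (ε * A') + a' * (ε * A) := by
        rw [h1, h2]
        exact add_le_add_three hlaw (mul_le_mul_of_nonneg_left hu' ha)
          (mul_le_mul_of_nonneg_left hu ha')
    _ ≤ ε * (a * ((1 + ε) * A') + a' * ((1 + ε) * A)) + a * (ε * A') + a' * (ε * A) := by
        gcongr
    _ = ε * (2 + ε) * (a * A' + a' * A) := by ring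
    _ ≤ 3 * ε * (a * A' + a' * A) := by
        have hS : 0 ≤ a * A' + a' * A := by positivity
        nlinarith [mul_nonneg hε hS]

/-- Scaling a double-ratio inequality by a positive factor on the second family. [folklore] -/
theorem doubleRatio_scale {a a' x x' k ε : ℝ} (hk : 0 < k)
    (h : |a * x' - a' * x| ≤ ε * (a * x' + a' * x)) :
    |a * (k * x') - a' * (k * x)| ≤ ε * (a * (k * x') + a' * (k * x)) := by
  have e1 : a * (k * x') - a' * (k * x) = k * (a * x' - a' * x) := by ring
  have e2 : a * (k * x') + a' * (k * x) = k * (a * x' + a' * x) := by ring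
  rw [e1, e2, abs_mul, abs_of_pos hk, mul_left_comm]
  exact mul_le_mul_of_nonneg_left h hk.le

/-- A convergent family is eventually `ε`-relatively close to its non-negative limit (trivially when the
limit vanishes and the family vanishes identically). [folklore] -/
theorem eventually_abs_sub_le_of_tendsto {f : ℝ → ℝ} {A ε : ℝ} (hε : 0 < ε) (hA : 0 ≤ A)
    (hf : Tendsto f (𝓝[>] 0) (𝓝 A)) (hdeg : A = 0 → ∀ δ, f δ = 0) :
    ∀ᶠ δ in 𝓝[>] (0 : ℝ), |f δ - A| ≤ ε * A := by
  rcases hA.eq_or_lt with h0 | hpos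
  · refine Eventually.of_forall fun δ => ?_
    rw [← h0, hdeg h0.symm δ, sub_zero, abs_zero, mul_zero]
  · have : ∀ᶠ δ in 𝓝[>] (0 : ℝ), dist (f δ) A < ε * A :=
      Metric.tendsto_nhds.1 hf _ (by positivity)
    filter_upwards [this] with δ hδ
    exact le_of_lt (by simpa [Real.dist_eq] using hδ)

/-- **Two families with the SAME limits obey the double-ratio law eventually**: if `a, u → A` and
`a', u' → A'` (and each family vanishes identically when its limit does), then eventually
`|a u' - a' u| ≤ ε (a u' + a' u)`. [folklore] -/
theorem eventually_doubleRatio_of_tendsto {a a' u u' : ℝ → ℝ} {A A' ε : ℝ} (hε : 0 < ε)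
    (hA : 0 ≤ A) (hA' : 0 ≤ A')
    (ha : Tendsto a (𝓝[>] 0) (𝓝 A)) (ha' : Tendsto a' (𝓝[>] 0) (𝓝 A'))
    (hu : Tendsto u (𝓝[>] 0) (𝓝 A)) (hu' : Tendsto u' (𝓝[>] 0) (𝓝 A'))
    (hdegA : A = 0 → ∀ δ, a δ = 0 ∧ u δ = 0) (hdegA' : A' = 0 → ∀ δ, a' δ = 0 ∧ u' δ = 0) :
    ∀ᶠ δ in 𝓝[>] (0 : ℝ), |a δ * u' δ - a' δ * u δ| ≤ ε * (a δ * u' δ + a' δ * u δ) := by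
  rcases hA.eq_or_lt with h0 | hApos
  · refine Eventually.of_forall fun δ => ?_
    obtain ⟨h1, h2⟩ := hdegA h0.symm δ
    rw [h1, h2]; simp
  rcases hA'.eq_or_lt with h0' | hA'pos
  · refine Eventually.of_forall fun δ => ?_
    obtain ⟨h1, h2⟩ := hdegA' h0'.symm δ
    rw [h1, h2]; simp
  have hP : 0 < A * A' := mul_pos hApos hA'pos
  have hdiff : Tendsto (fun δ => a δ * u' δ - a' δ * u δ) (𝓝[>] 0) (𝓝 0) := by
    have := (ha.mul hu').sub (ha'.mul hu)
    rwa [show A * A' - A' * A = 0 by ring] at this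
  have hsum : Tendsto (fun δ => a δ * u' δ + a' δ * u δ) (𝓝[>] 0) (𝓝 (2 * (A * A'))) := by
    have := (ha.mul hu').add (ha'.mul hu)
    rwa [show A * A' + A' * A = 2 * (A * A') by ring] at this
  have h1 : ∀ᶠ δ in 𝓝[>] (0 : ℝ), |a δ * u' δ - a' δ * u δ| < ε * (A * A') := by
    have := Metric.tendsto_nhds.1 hdiff _ (mul_pos hε hP)
    filter_upwards [this] with δ hδ
    simpa [Real.dist_eq] using hδ
  have h2 : ∀ᶠ δ in 𝓝[>] (0 : ℝ), A * A' < a δ * u' δ + a' δ * u δ :=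
    hsum.eventually (lt_mem_nhds (by linarith))
  filter_upwards [h1, h2] with δ hδ1 hδ2
  have : ε * (A * A') ≤ ε * (a δ * u' δ + a' δ * u δ) := mul_le_mul_of_nonneg_left hδ2.le hε.le
  linarith

/-! ### The kernel window datum of a flat-marked rectilinear rectangle (landed stubs chained) -/

/-- **The kernel window law, assembled from the landed stubs.** For a rectilinear `R` with flat marks:
a Carathéodory datum `(φ, g, S₀, S)` of `stub_boundaryCorrespondence` and ONE positive normaliser `c δ`
such that `c δ · (rowMass R δ s - rowMass R δ s') → C(s) - C(s')` for every fixed window in an admissible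
range, `C = contTail R g` (chain `stub_boundaryCorrespondence → stub_schwarzExtension →
stub_kernelPointAsymptotics → stub_kernelWindowLaw`). [folklore] -/
theorem exists_kernelWindowDatum (R : ConformalRectangle) (hR : IsRectilinear R)
    (hF : ∀ i : Fin 4, ∃ r : ℝ, 0 < r ∧ FlatNear R (R.pt i) r) :
    ∃ (φ : ConformalEquiv upperHalfPlaneSet R.carrier) (g : ℝ → ℝ) (S₀ S : ℝ),
      S₀ < 0 ∧ R.mark 3 < S ∧ S < 1 ∧ S < S₀ + 1 ∧
      ContinuousOn g (Icc S₀ S) ∧ (StrictMonoOn g (Icc S₀ S) ∨ StrictAntiOn g (Icc S₀ S)) ∧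
      (∀ t ∈ Icc S₀ S, φ.HasBoundaryValue (g t) (R.boundary t)) ∧
      ∃ c : ℝ → ℝ, (∀ δ, 0 < c δ) ∧
        ∀ σ σ' : ℝ, AdmissibleRange R σ σ' → ∀ s s' : ℝ, σ ≤ s → s ≤ s' → s' ≤ σ' →
          Tendsto (fun δ => c δ * (rowMass R δ s - rowMass R δ s')) (𝓝[>] 0)
            (𝓝 (contTail R g s - contTail R g s')) := by
  obtain ⟨φ, g, S₀, S, w₀, hS₀, h3S, hS1, hSS₀, hgc, hgm, hbv, hw₀φ, hw₀c, hw₀g⟩ :=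
    stub_boundaryCorrespondence R
  obtain ⟨U, w, hUo, hΩU, hflatU, hwd, hwbij, hwφ⟩ :=
    stub_schwarzExtension R φ g S₀ S w₀ hS₀ h3S hS1 hSS₀ hgc hgm hbv hw₀φ hw₀c hw₀g
  have hmI : ∀ i : Fin 4, R.mark i ∈ Icc (0 : ℝ) (R.mark 3) := fun i =>
    ⟨(R.mark_mem i).1, R.strictMono_mark.monotone (Fin.le_last i)⟩
  have hptU : ∀ i : Fin 4, R.pt i ∈ U ∧ w (R.pt i) = g (R.mark i) := fun i =>
    hflatU (R.mark i) (hmI i) (hF i)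
  obtain ⟨N, hNpos, hN⟩ := stub_kernelPointAsymptotics R hR hF U w hUo hΩU (hptU 0).1 (hptU 1).1
    (hptU 3).1 hwd hwbij
  obtain ⟨c, hcpos, hclaw⟩ := stub_kernelWindowLaw R hR hF φ g S₀ S w₀ hS₀ h3S hS1 hSS₀ hgc hgm hbv
    hw₀φ hw₀c hw₀g U w hUo hΩU hflatU hwd hwbij hwφ N hNpos hN
  exact ⟨φ, g, S₀, S, hS₀, h3S, hS1, hSS₀, hgc, hgm, hbv, c, hcpos, hclaw⟩

/-! ### The tail crossing probability is the crossing probability of a re-marked rectangle -/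

/-- **The tail crossing probability `Q_δ(p)` IS the crossing probability of the re-marked rectangle
`(Ω; a, b, ∂Ω(p), d)`** for `p ∈ (mark 1, mark 3)`: so Cardy's formula for rectilinear rectangles gives
`Q_δ(p) → C(p) = F(η(g a, g b, g p, g d))` for the boundary correspondence `g` of any uniformizer.
[folklore] -/
theorem tendsto_tailCrossingProb_of_rectilinearCardy (h : RectilinearCardy) (R : ConformalRectangle)
    (hR : IsRectilinear R) {φ : ConformalEquiv upperHalfPlaneSet R.carrier} {g : ℝ → ℝ} {S₀ S : ℝ}
    (hS₀ : S₀ < 0) (h3S : R.mark 3 < S)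
    (hgm : StrictMonoOn g (Icc S₀ S) ∨ StrictAntiOn g (Icc S₀ S))
    (hbv : ∀ t ∈ Icc S₀ S, φ.HasBoundaryValue (g t) (R.boundary t))
    {p : ℝ} (h1p : R.mark 1 < p) (hp3 : p < R.mark 3) :
    Tendsto (fun δ => tailCrossingProb R δ p) (𝓝[>] 0) (𝓝 (contTail R g p)) := by
  have h01 : R.mark 0 < R.mark 1 := R.strictMono_mark (show (0 : Fin 4) < 1 by decide)
  -- the re-marked rectangle `R♯ = (Ω; a, b, ∂Ω(p), d)` (same Jordan domain)
  let m : Fin 4 → ℝ := ![R.mark 0, R.mark 1, p, R.mark 3]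
  have hm0 : m 0 = R.mark 0 := rfl
  have hm1 : m 1 = R.mark 1 := rfl
  have hm2 : m 2 = p := rfl
  have hm3 : m 3 = R.mark 3 := rfl
  have hm : StrictMono m := by
    refine Fin.strictMono_iff_lt_succ.2 fun i => ?_
    fin_cases i
    · exact h01
    · exact h1p
    · exact hp3
  have h31 : m (Fin.last 3) < 1 := (R.mark_mem 3).2
  have hmem : ∀ i : Fin 4, m i ∈ Ico (0 : ℝ) 1 := fun i =>
    ⟨(R.mark_mem 0).1.trans (hm.monotone (Fin.zero_le i)),
      lt_of_le_of_lt (hm.monotone (Fin.le_last i)) h31⟩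
  let R' : ConformalRectangle :=
    { toJordanDomain := R.toJordanDomain
      mark := m
      strictMono_mark := hm
      mark_mem := hmem }
  have hR' : IsRectilinear R' := hR
  -- its crossing probability, read on `R`
  have h0' : R'.arc 0 = R.arc 0 := by
    show R.boundary '' Icc (m 0) (R'.nextMark 0) = R.boundary '' Icc (R.mark 0) (R.nextMark 0)
    rw [R'.nextMark_zero, R.nextMark_zero]
    rfl
  have h2' : R'.arc 2 = tailArc R p := by
    show R.boundary '' Icc (m 2) (R'.nextMark 2) = R.boundary '' Icc p (R.mark 3)
    rw [R'.nextMark_two]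
    rfl
  have heq : bondDomainCrossingProb R' = fun δ => tailCrossingProb R δ p := by
    funext δ
    show discreteCrossingProb half R.carrier δ (R'.arc 0) (R'.arc 2) = _
    rw [h0', h2']
    rfl
  -- `(φ, (g (m i))ᵢ)` is a uniformizing datum of `R♯`
  have hmI : ∀ i : Fin 4, m i ∈ Icc S₀ S := fun i =>
    ⟨hS₀.le.trans ((R.mark_mem 0).1.trans (hm.monotone (Fin.zero_le i))),
      (hm.monotone (Fin.le_last i)).trans h3S.le⟩
  have hx : StrictMono (fun i => g (m i)) ∨ StrictAnti (fun i => g (m i)) :=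
    hgm.imp (fun h a b hab => h (hmI a) (hmI b) (hm hab))
      (fun h a b hab => h (hmI a) (hmI b) (hm hab))
  have hU' : R'.IsUniformizing φ (fun i => g (m i)) := ⟨hx, fun i => hbv _ (hmI i)⟩
  have hlim := h R' hR' φ (fun i => g (m i)) hU'
  rw [heq] at hlim
  have hC : contTail R g p = cardyFunction (crossRatio fun i => g (m i)) := by
    unfold contTail
    congr 2
    funext i
    fin_cases i <;> rfl
  rwa [hC]


end Summit.CriticalPhenomena.CardyFormulaZ2.Cruxes.RectilinearCardy.ExcursionKernelCovariance

end
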